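import Literature.NumberTheory.Sieve.LinearEquationsInPrimesLevelTwoInputs
import Mathlib.Analysis.Fourier.AddCircleMulti
import Mathlib.MeasureTheory.Group.Integral
import HarnessLib

/-!
# Route `GreenTaoLevelTwo`, crux `MNTwo` (stmt-Parity-21276), line `birth`: vertical Fourier
# components along a central frame (the harmonic-analysis core of `stub_verticalReduction`, I)

Given a nilmanifold `Y = (G/Γ, d)` and a central frame `ι : ℝ^I → Z(G)` (a continuous
homomorphism onto the centre with `ι(ℤ^I) ⊆ Γ`; see `…MNTwoCentralFrames`), every `F : G/Γ → ℝ`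
and base point `x` give a continuous function on the torus `(ℝ/ℤ)^I`,
`τ ↦ F(ι(τ̃) · x)` (`τ̃` any lift — well defined because `ι(ℤ^I) ⊆ Γ ∩ Z(G)` acts trivially),
whose multi-dimensional Fourier coefficients (Mathlib's `UnitAddTorus.mFourierCoeff`) are the
VERTICAL COMPONENTS `F_ξ(x) = ∫_{(ℝ/ℤ)^I} e(-ξ·τ) F(ι(τ̃)·x) dτ` of Green–Tao 2012a Lemma 3.7.
This file proves the structural facts the vertical reduction needs about them:

* well-definedness / periodicity (`smul_intFrame`, `torusFun_coe`), the translation rule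
  `f_x(τ + u) = f_{ι(u)·x}(τ)` (`torusFun_add_coe`) and continuity (`continuous_torusFun`);
* `F_ξ` is a VERTICAL CHARACTER: `F_ξ(ι(u)·x) = e(ξ·u) F_ξ(x)` (`vComp_frame_smul`), hence
  transforms under every central `z` by `e(θ(z))` (`vComp_isVertical`, the skeleton's
  `IsVertical` shape with `θ(z) = ξ · ι⁻¹(z)`);
* `|F_ξ| ≤ 1` for `1`-bounded `F` (`norm_vComp_le_one`) and `F_ξ` is `L M`-Lipschitz when `F` is
  `M`-Lipschitz and the frame translations are `L`-Lipschitz (`norm_vComp_sub_vComp_le`) — a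
  Lipschitz constant independent of `ξ`, as the bookkeeping layer
  (`…MNTwoVerticalReductionBookkeeping`) requires.

All statements are definition-free (the torus function and the components are written out).

References: B. Green, T. Tao, *The Möbius function is strongly orthogonal to nilsequences*,
Ann. of Math. 175 (2012), Def. 3.3–Lemma 3.7 [GreenTao2012Mobius].
-/

noncomputable section

open MeasureTheory
open Literature.NumberTheory.Sieve

/- Measure convention: `UnitAddTorus.mFourierCoeff` integrates against Mathlib's normalised Haar
measure of `(ℝ/ℤ)^I` (total mass `1`, a local `MeasureSpace` instance of
`Mathlib.Analysis.Fourier.AddCircleMulti`); below the unfolded coefficient is re-read (`change`,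
definitionally) as an integral against `Measure.pi fun _ => AddCircle.haarAddCircle`, whose
invariance / finiteness instances are global. -/

namespace Summit.Parity.GeneralizedHardyLittlewood.GreenTaoLevelTwoMNTwoVerticalComponents

variable {s : ℕ} (Y : Nilmanifold s) {I : Type} (ι : (I → ℝ) → Y.G)

/-! ### §1 The frame acting on `G/Γ`: integer vectors act trivially -/

/-- A central lattice element acts trivially on `G/Γ`: `γ · gΓ = g γ Γ = gΓ`. [folklore] -/
theorem smul_eq_self_of_mem_center_of_mem {γ : Y.G} (hc : γ ∈ Subgroup.center Y.G) (hΓ : γ ∈ Y.Γ)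
    (x : Y.G ⧸ Y.Γ) : γ • x = x := by
  obtain ⟨g, rfl⟩ := QuotientGroup.mk_surjective x
  rw [MulAction.Quotient.smul_mk, smul_eq_mul, QuotientGroup.eq]
  rw [Subgroup.mem_center_iff] at hc
  have hc' : g⁻¹ * γ⁻¹ = γ⁻¹ * g⁻¹ := by rw [← mul_inv_rev, ← mul_inv_rev, hc g]
  have h : (γ * g)⁻¹ * g = γ⁻¹ := by
    calc (γ * g)⁻¹ * g = g⁻¹ * γ⁻¹ * g := by rw [mul_inv_rev]
      _ = γ⁻¹ * g⁻¹ * g := by rw [hc']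
      _ = γ⁻¹ := by group
  rw [h]
  exact Y.Γ.inv_mem hΓ

/-- Translating the frame parameter by an INTEGER vector does not change the action on `G/Γ`
(`ι(ℤ^I) ⊆ Γ ∩ Z(G)`). [cite: GreenTao2012Mobius, Def. 3.3] -/
theorem smul_intFrame (hadd : ∀ t u, ι (t + u) = ι t * ι u)
    (hcen : ∀ t, ι t ∈ Subgroup.center Y.G) (hΓ : ∀ n : I → ℤ, ι (fun i => (n i : ℝ)) ∈ Y.Γ)
    (v : I → ℝ) (n : I → ℤ) (x : Y.G ⧸ Y.Γ) :
    ι (v + fun i => (n i : ℝ)) • x = ι v • x := by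
  rw [hadd, mul_smul, smul_eq_self_of_mem_center_of_mem Y (hcen _) (hΓ n)]

/-! ### §2 The torus function `τ ↦ F(ι(τ̃) · x)` -/

/-- The canonical lift `τ̃ ∈ [0,1)^I` of a point of the torus `(ℝ/ℤ)^I` projects back to it.
[folklore] -/
theorem coe_lift (τ : UnitAddTorus I) (i : I) :
    (((AddCircle.equivIco (1 : ℝ) 0 (τ i) : ℝ) : UnitAddCircle)) = τ i :=
  AddCircle.coe_equivIco

/-- The lift of (the projection of) a real vector differs from it by an integer vector.
[folklore] -/
theorem exists_lift_coe_eq_add (v : I → ℝ) :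
    ∃ n : I → ℤ, (fun i => (AddCircle.equivIco (1 : ℝ) 0 ((v i : ℝ) : UnitAddCircle) : ℝ)) =
      v + fun i => (n i : ℝ) := by
  have h : ∀ i, ∃ k : ℤ,
      (AddCircle.equivIco (1 : ℝ) 0 ((v i : ℝ) : UnitAddCircle) : ℝ) = v i + k := by
    intro i
    have e : (((AddCircle.equivIco (1 : ℝ) 0 ((v i : ℝ) : UnitAddCircle) : ℝ) : UnitAddCircle)) =
        ((v i : ℝ) : UnitAddCircle) := AddCircle.coe_equivIco
    rw [QuotientAddGroup.eq, AddSubgroup.mem_zmultiples_iff] at e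
    obtain ⟨k, hk⟩ := e
    refine ⟨-k, ?_⟩
    have hk' : (k : ℝ) = -(AddCircle.equivIco (1 : ℝ) 0 ((v i : ℝ) : UnitAddCircle) : ℝ) + v i := by
      rw [← hk]; simp
    push_cast
    linarith
  choose n hn using h
  exact ⟨n, funext fun i => by simp [hn i]⟩

/-- **Well-definedness**: on projected vectors the torus function is `F(ι(v) · x)`.
[cite: GreenTao2012Mobius, Def. 3.3] -/
theorem torusFun_coe (hadd : ∀ t u, ι (t + u) = ι t * ι u)
    (hcen : ∀ t, ι t ∈ Subgroup.center Y.G) (hΓ : ∀ n : I → ℤ, ι (fun i => (n i : ℝ)) ∈ Y.Γ)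
    (F : Y.G ⧸ Y.Γ → ℝ) (x : Y.G ⧸ Y.Γ) (v : I → ℝ) :
    F (ι (fun i => (AddCircle.equivIco (1 : ℝ) 0 (((v i : ℝ) : UnitAddCircle)) : ℝ)) • x) =
      F (ι v • x) := by
  obtain ⟨n, hn⟩ := exists_lift_coe_eq_add v
  rw [hn, smul_intFrame Y ι hadd hcen hΓ]

/-- **Translation rule**: `f_x(τ + u) = f_{ι(u)·x}(τ)` for real vectors `u`.
[cite: GreenTao2012Mobius, Def. 3.3] -/
theorem torusFun_add_coe (hadd : ∀ t u, ι (t + u) = ι t * ι u)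
    (hcen : ∀ t, ι t ∈ Subgroup.center Y.G) (hΓ : ∀ n : I → ℤ, ι (fun i => (n i : ℝ)) ∈ Y.Γ)
    (F : Y.G ⧸ Y.Γ → ℝ) (x : Y.G ⧸ Y.Γ) (τ : UnitAddTorus I) (u : I → ℝ) :
    F (ι (fun i => (AddCircle.equivIco (1 : ℝ) 0 ((τ + fun i => ((u i : ℝ) : UnitAddCircle)) i) : ℝ)) • x) =
      F (ι (fun i => (AddCircle.equivIco (1 : ℝ) 0 (τ i) : ℝ)) • (ι u • x)) := by
  -- write `τ = π(τ̃)`; then `τ + π u = π(τ̃ + u)`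
  set w : I → ℝ := fun i => (AddCircle.equivIco (1 : ℝ) 0 (τ i) : ℝ) with hw
  have hτ : (τ + fun i => ((u i : ℝ) : UnitAddCircle)) = fun i => (((w + u) i : ℝ) : UnitAddCircle) := by
    funext i
    simp only [Pi.add_apply, hw, AddCircle.coe_add, coe_lift]
  rw [hτ, torusFun_coe Y ι hadd hcen hΓ F x (w + u), hadd, mul_smul]

/-- **Continuity** of the torus function for continuous `F` and `ι` (the projection
`ℝ^I → (ℝ/ℤ)^I` is an open quotient map and `f_x ∘ π = v ↦ F(ι(v)·x)` is continuous).
[cite: GreenTao2012Mobius, Def. 3.3] -/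
theorem continuous_torusFun (hadd : ∀ t u, ι (t + u) = ι t * ι u)
    (hcen : ∀ t, ι t ∈ Subgroup.center Y.G) (hΓ : ∀ n : I → ℤ, ι (fun i => (n i : ℝ)) ∈ Y.Γ)
    (hcont : Continuous ι) {F : Y.G ⧸ Y.Γ → ℝ} (hF : Continuous F) (x : Y.G ⧸ Y.Γ) :
    Continuous fun τ : UnitAddTorus I =>
      F (ι (fun i => (AddCircle.equivIco (1 : ℝ) 0 (τ i) : ℝ)) • x) := by
  have hπ : IsOpenQuotientMap (fun v : I → ℝ => fun i => ((v i : ℝ) : UnitAddCircle)) :=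
    IsOpenQuotientMap.piMap fun _ => QuotientAddGroup.isOpenQuotientMap_mk
  rw [← hπ.continuous_comp_iff]
  have e : (fun τ : UnitAddTorus I => F (ι (fun i => (AddCircle.equivIco (1 : ℝ) 0 (τ i) : ℝ)) • x)) ∘
      (fun v : I → ℝ => fun i => ((v i : ℝ) : UnitAddCircle)) = fun v => F (ι v • x) := by
    funext v
    exact torusFun_coe Y ι hadd hcen hΓ F x v
  rw [e]
  have hsmul : Continuous fun g : Y.G => g • x := by
    obtain ⟨g₀, rfl⟩ := QuotientGroup.mk_surjective x
    exact (QuotientGroup.continuous_mk.comp (continuous_id.mul continuous_const)).congr fun g => rfl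
  exact hF.comp (hsmul.comp hcont)


/-! ### §3 Exponential monomials on `(ℝ/ℤ)^I`: character identities -/

/-- `e_n(x + y) = e_n(x) e_n(y)`. [folklore] -/
theorem mFourier_add_arg [Fintype I] (n : I → ℤ) (x y : UnitAddTorus I) :
    UnitAddTorus.mFourier n (x + y) = UnitAddTorus.mFourier n x * UnitAddTorus.mFourier n y := by
  simp only [UnitAddTorus.mFourier, ContinuousMap.coe_mk, Pi.add_apply, fourier_apply, smul_add,
    AddCircle.toCircle_add, Circle.coe_mul, Finset.prod_mul_distrib]

/-- `e_{-n}(-y) = e_n(y)`. [folklore] -/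
theorem mFourier_neg_neg [Fintype I] (n : I → ℤ) (y : UnitAddTorus I) :
    UnitAddTorus.mFourier (-n) (-y) = UnitAddTorus.mFourier n y := by
  simp only [UnitAddTorus.mFourier, ContinuousMap.coe_mk, Pi.neg_apply, fourier_apply, neg_smul,
    smul_neg, neg_neg]

/-- `|e_n(x)| = 1`. [folklore] -/
theorem norm_mFourier_apply [Fintype I] (n : I → ℤ) (x : UnitAddTorus I) :
    ‖UnitAddTorus.mFourier n x‖ = 1 := by
  simp only [UnitAddTorus.mFourier, fourier_apply, ContinuousMap.coe_mk, norm_prod, Circle.norm_coe,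
    Finset.prod_const_one]

/-- `e_n(π(t)) = exp(2πi ∑ᵢ nᵢ tᵢ)` on projected real vectors. [folklore] -/
theorem mFourier_coe_eq_exp [Fintype I] (n : I → ℤ) (t : I → ℝ) :
    UnitAddTorus.mFourier n (fun i => ((t i : ℝ) : UnitAddCircle)) =
      Complex.exp (2 * Real.pi * Complex.I * ((∑ i, (n i : ℝ) * t i : ℝ) : ℂ)) := by
  simp only [UnitAddTorus.mFourier, ContinuousMap.coe_mk, fourier_coe_apply]
  rw [← Complex.exp_sum]
  congr 1
  push_cast
  rw [Finset.mul_sum]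
  refine Finset.sum_congr rfl fun i _ => ?_
  ring

/-! ### §4 The vertical components `F_n(x) = ∫ e_{-n}(τ) F(ι(τ̃)·x) dτ` -/


/-- **Vertical components are vertical characters along the frame**:
`F_n(ι(u)·x) = e_n(π u) F_n(x)` (translate the Haar integral by `π u`).
[cite: GreenTao2012Mobius, Def. 3.3–Lemma 3.7] -/
theorem vComp_frame_smul [Fintype I] (hadd : ∀ t u, ι (t + u) = ι t * ι u)
    (hcen : ∀ t, ι t ∈ Subgroup.center Y.G) (hΓ : ∀ n : I → ℤ, ι (fun i => (n i : ℝ)) ∈ Y.Γ)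
    (F : Y.G ⧸ Y.Γ → ℝ) (x : Y.G ⧸ Y.Γ) (n : I → ℤ) (u : I → ℝ) :
    UnitAddTorus.mFourierCoeff
        (fun τ : UnitAddTorus I => (F (ι (fun i => (AddCircle.equivIco (1 : ℝ) 0 (τ i) : ℝ)) • (ι u • x)) : ℂ)) n =
      UnitAddTorus.mFourier n (fun i => ((u i : ℝ) : UnitAddCircle)) *
        UnitAddTorus.mFourierCoeff
          (fun τ : UnitAddTorus I => (F (ι (fun i => (AddCircle.equivIco (1 : ℝ) 0 (τ i) : ℝ)) • x) : ℂ)) n := by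
  unfold UnitAddTorus.mFourierCoeff
  -- name the measure: Mathlib's normalised Haar measure of the torus is `⨂ haarAddCircle`
  change ∫ τ, _ ∂(Measure.pi fun _ : I => AddCircle.haarAddCircle) =
    _ * ∫ τ, _ ∂(Measure.pi fun _ : I => AddCircle.haarAddCircle)
  set πu : UnitAddTorus I := fun i => ((u i : ℝ) : UnitAddCircle) with hπu
  set f : UnitAddTorus I → ℂ :=
    fun τ => (F (ι (fun i => (AddCircle.equivIco (1 : ℝ) 0 (τ i) : ℝ)) • x) : ℂ) with hf
  set g : UnitAddTorus I → ℂ := fun σ => UnitAddTorus.mFourier (-n) (σ - πu) • f σ with hg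
  -- the integrand on the left is `g (π u + τ)`
  have e1 : (fun τ : UnitAddTorus I => UnitAddTorus.mFourier (-n) τ •
      (F (ι (fun i => (AddCircle.equivIco (1 : ℝ) 0 (τ i) : ℝ)) • (ι u • x)) : ℂ)) =
      fun τ => g (πu + τ) := by
    funext τ
    rw [hg]
    simp only
    rw [add_sub_cancel_left, hf]
    simp only
    rw [add_comm πu τ, ← torusFun_add_coe Y ι hadd hcen hΓ F x τ u]
  rw [e1, integral_add_left_eq_self g πu, hg]
  simp only
  -- `e_{-n}(σ - πu) = e_{-n}(σ) e_n(πu)`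
  have e2 : ∀ σ : UnitAddTorus I, UnitAddTorus.mFourier (-n) (σ - πu) =
      UnitAddTorus.mFourier (-n) σ * UnitAddTorus.mFourier n πu := by
    intro σ
    rw [sub_eq_add_neg, mFourier_add_arg, mFourier_neg_neg]
  simp_rw [e2, smul_eq_mul]
  rw [← integral_const_mul]
  refine integral_congr_ae (Filter.Eventually.of_forall fun σ => ?_)
  ring

/-- **`|F_n| ≤ 1`** for `1`-bounded `F` (`|e_{-n}| = 1`, total mass `1`).
[cite: GreenTao2012Mobius, Lemma 3.7] -/
theorem norm_vComp_le_one [Fintype I] {F : Y.G ⧸ Y.Γ → ℝ} (hF : ∀ y, |F y| ≤ 1)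
    (x : Y.G ⧸ Y.Γ) (n : I → ℤ) :
    ‖UnitAddTorus.mFourierCoeff
        (fun τ : UnitAddTorus I => (F (ι (fun i => (AddCircle.equivIco (1 : ℝ) 0 (τ i) : ℝ)) • x) : ℂ)) n‖ ≤ 1 := by
  unfold UnitAddTorus.mFourierCoeff
  change ‖∫ τ, _ ∂(Measure.pi fun _ : I => AddCircle.haarAddCircle)‖ ≤ 1
  refine (norm_integral_le_of_norm_le_const (C := 1) (Filter.Eventually.of_forall fun τ => ?_)).trans ?_
  · rw [norm_smul, norm_mFourier_apply, one_mul, Complex.norm_real, Real.norm_eq_abs]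
    exact hF _
  · simp

/-- **`F_n` is `L M`-Lipschitz** when `F` is `M`-Lipschitz (`M ≥ 0`) and the frame translations
are `L`-Lipschitz — a constant independent of `n`. [cite: GreenTao2012Mobius, Lemma 3.7] -/
theorem norm_vComp_sub_vComp_le [Fintype I] (hadd : ∀ t u, ι (t + u) = ι t * ι u)
    (hcen : ∀ t, ι t ∈ Subgroup.center Y.G) (hΓ : ∀ n : I → ℤ, ι (fun i => (n i : ℝ)) ∈ Y.Γ)
    (hcont : Continuous ι) {L M : ℝ} (hM : 0 ≤ M)
    (hlip : ∀ (t : I → ℝ) (p q : Y.G ⧸ Y.Γ), Y.dist (ι t • p) (ι t • q) ≤ L * Y.dist p q)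
    {F : Y.G ⧸ Y.Γ → ℝ} (hF : Y.IsBoundedLipschitz M F) (x y : Y.G ⧸ Y.Γ) (n : I → ℤ) :
    ‖UnitAddTorus.mFourierCoeff
          (fun τ : UnitAddTorus I => (F (ι (fun i => (AddCircle.equivIco (1 : ℝ) 0 (τ i) : ℝ)) • x) : ℂ)) n -
        UnitAddTorus.mFourierCoeff
          (fun τ : UnitAddTorus I => (F (ι (fun i => (AddCircle.equivIco (1 : ℝ) 0 (τ i) : ℝ)) • y) : ℂ)) n‖ ≤
      L * M * Y.dist x y := by
  unfold UnitAddTorus.mFourierCoeff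
  change ‖∫ τ, _ ∂(Measure.pi fun _ : I => AddCircle.haarAddCircle) -
    ∫ τ, _ ∂(Measure.pi fun _ : I => AddCircle.haarAddCircle)‖ ≤ _
  -- integrability of both integrands (continuous and bounded; any finite measure)
  have hint : ∀ (μ : Measure (UnitAddTorus I)) [IsFiniteMeasure μ] (z : Y.G ⧸ Y.Γ),
      Integrable (fun τ : UnitAddTorus I => UnitAddTorus.mFourier (-n) τ •
        (F (ι (fun i => (AddCircle.equivIco (1 : ℝ) 0 (τ i) : ℝ)) • z) : ℂ)) μ := by
    intro μ _ z
    have hc : Continuous fun τ : UnitAddTorus I => UnitAddTorus.mFourier (-n) τ •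
        (F (ι (fun i => (AddCircle.equivIco (1 : ℝ) 0 (τ i) : ℝ)) • z) : ℂ) :=
      (UnitAddTorus.mFourier (-n)).continuous.smul
        (Complex.continuous_ofReal.comp (continuous_torusFun Y ι hadd hcen hΓ hcont hF.continuous z))
    refine Integrable.mono' (integrable_const (1 : ℝ)) hc.aestronglyMeasurable
      (Filter.Eventually.of_forall fun τ => ?_)
    rw [norm_smul, norm_mFourier_apply, one_mul, Complex.norm_real, Real.norm_eq_abs]
    exact hF.1 _
  rw [← integral_sub (hint _ x) (hint _ y)]
  refine (norm_integral_le_of_norm_le_const (C := L * M * Y.dist x y)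
    (Filter.Eventually.of_forall fun τ => ?_)).trans ?_
  · rw [← smul_sub, norm_smul, norm_mFourier_apply, one_mul, ← Complex.ofReal_sub, Complex.norm_real,
      Real.norm_eq_abs]
    set t : I → ℝ := fun i => (AddCircle.equivIco (1 : ℝ) 0 (τ i) : ℝ)
    calc |F (ι t • x) - F (ι t • y)| ≤ M * Y.dist (ι t • x) (ι t • y) := hF.2 _ _
      _ ≤ M * (L * Y.dist x y) := mul_le_mul_of_nonneg_left (hlip t x y) hM
      _ = L * M * Y.dist x y := by ring
  · simp

/-! ### §5 The skeleton's verticality: transformation under the whole centre -/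

/-- A complex number is its real part plus `i` times its imaginary part (the skeleton's
`F₁ + i F₂` packaging). [folklore] -/
theorem re_add_im_mul_I (c : ℂ) : ((c.re : ℂ) + (c.im : ℂ) * Complex.I) = c :=
  Complex.re_add_im c

/-- **The vertical components are vertical characters in the skeleton's sense**: if the frame
maps ONTO the centre, then `F_n = F₁ + i F₂` transforms under every central `z` by the character
`e(θ(z))`, `θ(z) = ∑ᵢ nᵢ tᵢ` for any `t` with `ι(t) = z` (the `IsVertical` clause of the `MNTwo`
skeleton, for the pair `(Re F_n, Im F_n)`). [cite: GreenTao2012Mobius, Def. 3.3–Lemma 3.7] -/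
theorem vComp_isVertical [Fintype I] (hadd : ∀ t u, ι (t + u) = ι t * ι u)
    (hcen : ∀ t, ι t ∈ Subgroup.center Y.G) (hΓ : ∀ n : I → ℤ, ι (fun i => (n i : ℝ)) ∈ Y.Γ)
    (hsurj : ∀ z ∈ Subgroup.center Y.G, ∃ t, ι t = z) (F : Y.G ⧸ Y.Γ → ℝ) (n : I → ℤ) :
    ∃ θ : Y.G → ℝ, ∀ z : Y.G, z ∈ Subgroup.center Y.G → ∀ x : Y.G ⧸ Y.Γ,
      (((UnitAddTorus.mFourierCoeff
            (fun τ : UnitAddTorus I => (F (ι (fun i => (AddCircle.equivIco (1 : ℝ) 0 (τ i) : ℝ)) • (z • x)) : ℂ)) n).re : ℂ) +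
        ((UnitAddTorus.mFourierCoeff
            (fun τ : UnitAddTorus I => (F (ι (fun i => (AddCircle.equivIco (1 : ℝ) 0 (τ i) : ℝ)) • (z • x)) : ℂ)) n).im : ℂ) *
          Complex.I) =
      Complex.exp (2 * Real.pi * Complex.I * θ z) *
        (((UnitAddTorus.mFourierCoeff
            (fun τ : UnitAddTorus I => (F (ι (fun i => (AddCircle.equivIco (1 : ℝ) 0 (τ i) : ℝ)) • x) : ℂ)) n).re : ℂ) +
          ((UnitAddTorus.mFourierCoeff
            (fun τ : UnitAddTorus I => (F (ι (fun i => (AddCircle.equivIco (1 : ℝ) 0 (τ i) : ℝ)) • x) : ℂ)) n).im : ℂ) *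
            Complex.I) := by
  classical
  -- choose a frame parameter for every central element (anything off the centre)
  refine ⟨fun z => if hz : z ∈ Subgroup.center Y.G then ∑ i, (n i : ℝ) * (hsurj z hz).choose i else 0,
    fun z hz x => ?_⟩
  rw [re_add_im_mul_I, re_add_im_mul_I]
  simp only [dif_pos hz]
  have htz : ι (hsurj z hz).choose = z := (hsurj z hz).choose_spec
  -- rewrite the central element as a frame element (only inside the action)
  have e : (fun τ : UnitAddTorus I =>
        (F (ι (fun i => (AddCircle.equivIco (1 : ℝ) 0 (τ i) : ℝ)) • (z • x)) : ℂ)) =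
      fun τ => (F (ι (fun i => (AddCircle.equivIco (1 : ℝ) 0 (τ i) : ℝ)) •
        (ι (hsurj z hz).choose • x)) : ℂ) := by
    rw [htz]
  rw [e, vComp_frame_smul Y ι hadd hcen hΓ F x n _, mFourier_coe_eq_exp]

end Summit.Parity.GeneralizedHardyLittlewood.GreenTaoLevelTwoMNTwoVerticalComponents
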